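import Summits.BirchSwinnertonDyer.Rank1Residual.X11b.BDPRouteTarget
import Summits.BirchSwinnertonDyer.Rank1Residual.X11b.TwistTransportTam
import HarnessLib

/-!
# Class X11b, route "BDP + converse-theorem engine + Kolyvagin": the sub-cell target from STEP L and the Manin-unit datum alone (cell `b2b-bsdres`, sub-cell `multr1-p2`)

HONEST FRAMING (cell `b2b-bsdres`, run/shared/lean/b2b/bsd-rank1-residual/, verbatim in every
file): the goal of the cell is to DELETE the COMBINATION-SHAPED residual classes of the
Birch–Swinnerton-Dyer formula for ALL analytic-rank `≤ 1` elliptic curves over `ℚ` — "full BSD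
formula for every rank `≤ 1` curve in class `C`" assembled STRICTLY from published theorems — so
that the rank-`≤ 1` remainder becomes exactly the CONSTRUCTION-SHAPED classes, which are TYPED
(missing-input `Prop`s), NOT attempted. This is not "finishing BSD". Sub-cell `multr1-p2` is a
RESEARCH ROUTE on class X11b; no claim beyond the stated class and locus; X11b's label does not
change.

THEOREMS ONLY (no definition, no named fact). `X11b/BDPRouteTarget.lean` derived the sub-cell target
"for every `(E,p)` in X11b with `p ≥ 5`, a (ram) prime and `p ∤ ∏ c_ℓ`, Miller's `BSD(E,p)`" from
the typed input STEP L, the published named facts of the tree, and TWO transport binders `hMan`,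
`hTam`. Here `hTam` (the `p`-part of the Tamagawa product of the minimal twist model equals that of
`E`) is DISCHARGED by the tree theorem `padicValNat_tamagawaProduct_twist_of_heegner`
(`X11b/TwistTransportTam.lean`: `c_ℓ` equal at the split `ℓ ∣ N`, `c_ℓ(E^{d_K}) ≤ 4 < p` at
`ℓ ∣ d_K` by the `j`-invariant and Kodaira–Néron), leaving
`bsdp_of_classX11b_of_locus_of_maninDatum`: the target from (i) STEP L (`IndexLowerBoundAt` at every
Heegner datum with Manin constant prime to `p`; OPEN at `p ∥ N` — no refereed proof, see
`X11b/BDPRoute.lean`), (ii) PUBLISHED named facts (Gross–Zagier, Kolyvagin 1990 ×2, Skinner 2016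
Thm. C, Gross–Zagier–Kolyvagin over `ℚ`, modularity ×2, Friedberg–Hoffstein), and (iii) ONE routine
binder `hMan`: a Heegner point on `E` over `K` of a modular-parametrisation datum whose Manin
constant is prime to `p` (for the optimal curve `c` is a `p`-unit at `p ∥ N`, `p` odd — Mazur 1978
Cor. 4.1 / Abbes–Ullmo 1996 — and Heegner points exist by CM theory, Gross 1984; transporting to an
arbitrary `E` in the isogeny class needs a prime-to-`p` isogeny or the isogeny invariance of
`BSD(E,p)`, which is why it stays a binder here).

References: [JetchevSkinnerWan2017] §7.3.1, §7.4; [Skinner2016PacificMC] Thm. C;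
[KolyvaginEulerSystems1990] Thm. A; [FriedbergHoffstein1995]; [Miller2011LMS] Def. 1.1.
-/

noncomputable section

open scoped Classical

open WeierstrassCurve NumberField Literature.NumberTheory.EllipticCurves
  Literature.NumberTheory.EllipticCurves.ModularForms
  Literature.NumberTheory.EllipticCurves.Rank1Residual

namespace Summit.BirchSwinnertonDyer.Rank1Residual.X11b

/-- **The sub-cell target from STEP L and the Manin-unit Heegner datum.** For every `(E,p)` in
X11b (`r_an = 1`, `p` odd, multiplicative at `p`, `E[p]` irreducible) on the `Locus` (`p ≥ 5`, a
(ram) prime, `p ∤ ∏ c_ℓ`): `BSD(E,p)` — from the typed input STEP L (`hL`), the published named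
facts `hGZ`, `hKo`, `hB`, `hSk`, `hGZK`, `hmod`, `hnf`, `hFH`, and the single remaining transport
binder `hMan` (a Heegner point of a modular parametrisation of level `N` with Manin constant prime
to `p`). Obtained from `bsdp_of_classX11b_of_locus_of_tamagawaTransport` by discharging its binder
`hTam` with `padicValNat_tamagawaProduct_twist_of_heegner`. CONDITIONAL on STEP L (no refereed
proof at `p ∥ N`); X11b stays CONSTRUCTION-SHAPED.
[cite: JetchevSkinnerWan2017, §7.4.1 (pp. 29–31)] [cite: Skinner2016PacificMC, Thm. C (§1)]
[cite: Miller2011LMS, Def. 1.1] -/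
theorem bsdp_of_classX11b_of_locus_of_maninDatum
    -- published inputs (named facts of the tree)
    (hGZ : ∀ (N : ℕ) [NeZero N] (W : WeierstrassCurve ℚ) (K : Type) [Field K] [NumberField K],
      gross_zagier N W K)
    (hKo : ∀ (N : ℕ) [NeZero N] (W : WeierstrassCurve ℚ) (K : Type) [Field K] [NumberField K],
      kolyvagin N W K)
    (hB : ∀ (N : ℕ) [NeZero N] (W : WeierstrassCurve ℚ) (K : Type) [Field K] [NumberField K],
      Kolyvagin1990_padicValNat_card_sha_le N W K)
    (hSk : Skinner2016.thmC_padicValRat_bsd_rank_zero)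
    (hGZK : rank_eq_analyticRank_of_analyticRank_le_one) (hmod : hasEntireLFunction_rat)
    (hnf : exists_isNewformOf)
    (hFH : friedbergHoffstein_exists_heegnerField_split_twist_ne_zero)
    -- transport package 1: a Heegner point of a datum with Manin constant prime to `p`
    (hMan : ∀ (W : WeierstrassCurve ℚ) [W.IsElliptic] [W.IsGloballyMinimal] (p : ℕ) [Fact p.Prime]
      (N : ℕ) [NeZero N] (K : Type) [Field K] [NumberField K],
      W.conductorNorm ℤ = N → 5 ≤ p → W.HasMultiplicativeReductionAtPrime p →
      W.HasIrreducibleModPGaloisRep p → IsImaginaryQuadratic K → SatisfiesHeegnerHypothesis N K →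
      ∃ (Dt : ModularParametrizationData W N) (H : HeegnerDatum N (NumberField.discr K))
        (ι : K →+* ℂ) (P : (W.baseChange K).toAffine.Point),
        WeierstrassCurve.Affine.Point.map ι.toRatAlgHom P = heegnerPointComplex Dt H ∧
          ¬ (p : ℤ) ∣ Dt.c)
    -- the typed input of the route (STEP L), at every Heegner datum with Manin constant prime to `p`
    (hL : ∀ (W : WeierstrassCurve ℚ) [W.IsElliptic] [W.IsGloballyMinimal] (p : ℕ) [Fact p.Prime]
      (N : ℕ) [NeZero N] (K : Type) [Field K] [NumberField K]
      (Dt : ModularParametrizationData W N) (H : HeegnerDatum N (NumberField.discr K)) (ι : K →+* ℂ)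
      (P : (W.baseChange K).toAffine.Point),
      ClassX11b W p → Locus W p → W.conductorNorm ℤ = N → IsImaginaryQuadratic K →
      SatisfiesHeegnerHypothesis N K →
      WeierstrassCurve.Affine.Point.map ι.toRatAlgHom P = heegnerPointComplex Dt H →
      ¬ (p : ℤ) ∣ Dt.c → IndexLowerBoundAt W p K P) :
    ∀ (W : WeierstrassCurve ℚ) [W.IsElliptic] [W.IsGloballyMinimal] (p : ℕ) [Fact p.Prime],
      ClassX11b W p → Locus W p → BSDp W p :=
  bsdp_of_classX11b_of_locus_of_tamagawaTransport hGZ hKo hB hSk hGZK hmod hnf hFH hMan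
    (fun W _ _ p _ K _ _ _Wd _ _ Cd hp5 hK hH _ _ hWd ↦
      padicValNat_tamagawaProduct_twist_of_heegner W p hp5 K hK hH Cd hWd) hL

/-- **`X11b.Statement` from STEP L and the Manin-unit datum.** The sub-cell target of record
(`@[conjecture] def Statement`, `X11b/BDPRoute.lean`; nothing asserted there) follows from STEP L
(`hL`), the published tree facts and the binder `hMan` — `bsdp_of_classX11b_of_locus_of_maninDatum`
read through `Statement`. CONDITIONAL on STEP L; X11b stays CONSTRUCTION-SHAPED.
[cite: JetchevSkinnerWan2017, §7.4.1 (pp. 29–31)] [cite: Miller2011LMS, Def. 1.1] -/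
theorem statement_of_indexLowerBoundAt_of_maninDatum
    -- published inputs (named facts of the tree)
    (hGZ : ∀ (N : ℕ) [NeZero N] (W : WeierstrassCurve ℚ) (K : Type) [Field K] [NumberField K],
      gross_zagier N W K)
    (hKo : ∀ (N : ℕ) [NeZero N] (W : WeierstrassCurve ℚ) (K : Type) [Field K] [NumberField K],
      kolyvagin N W K)
    (hB : ∀ (N : ℕ) [NeZero N] (W : WeierstrassCurve ℚ) (K : Type) [Field K] [NumberField K],
      Kolyvagin1990_padicValNat_card_sha_le N W K)
    (hSk : Skinner2016.thmC_padicValRat_bsd_rank_zero)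
    (hGZK : rank_eq_analyticRank_of_analyticRank_le_one) (hmod : hasEntireLFunction_rat)
    (hnf : exists_isNewformOf)
    (hFH : friedbergHoffstein_exists_heegnerField_split_twist_ne_zero)
    -- transport package 1: a Heegner point of a datum with Manin constant prime to `p`
    (hMan : ∀ (W : WeierstrassCurve ℚ) [W.IsElliptic] [W.IsGloballyMinimal] (p : ℕ) [Fact p.Prime]
      (N : ℕ) [NeZero N] (K : Type) [Field K] [NumberField K],
      W.conductorNorm ℤ = N → 5 ≤ p → W.HasMultiplicativeReductionAtPrime p →
      W.HasIrreducibleModPGaloisRep p → IsImaginaryQuadratic K → SatisfiesHeegnerHypothesis N K →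
      ∃ (Dt : ModularParametrizationData W N) (H : HeegnerDatum N (NumberField.discr K))
        (ι : K →+* ℂ) (P : (W.baseChange K).toAffine.Point),
        WeierstrassCurve.Affine.Point.map ι.toRatAlgHom P = heegnerPointComplex Dt H ∧
          ¬ (p : ℤ) ∣ Dt.c)
    -- the typed input of the route (STEP L), at every Heegner datum with Manin constant prime to `p`
    (hL : ∀ (W : WeierstrassCurve ℚ) [W.IsElliptic] [W.IsGloballyMinimal] (p : ℕ) [Fact p.Prime]
      (N : ℕ) [NeZero N] (K : Type) [Field K] [NumberField K]
      (Dt : ModularParametrizationData W N) (H : HeegnerDatum N (NumberField.discr K)) (ι : K →+* ℂ)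
      (P : (W.baseChange K).toAffine.Point),
      ClassX11b W p → Locus W p → W.conductorNorm ℤ = N → IsImaginaryQuadratic K →
      SatisfiesHeegnerHypothesis N K →
      WeierstrassCurve.Affine.Point.map ι.toRatAlgHom P = heegnerPointComplex Dt H →
      ¬ (p : ℤ) ∣ Dt.c → IndexLowerBoundAt W p K P) :
    Statement :=
  fun W _ _ p _ hX hloc ↦
    bsdp_of_classX11b_of_locus_of_maninDatum hGZ hKo hB hSk hGZK hmod hnf hFH hMan hL W p hX hloc

end Summit.BirchSwinnertonDyer.Rank1Residual.X11b

end
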